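import Summits.BirchSwinnertonDyer.BirchSwinnertonDyer.Theorems.EisensteinPrimesAcTwistDeformationLocSurj
import Summits.BirchSwinnertonDyer.BirchSwinnertonDyer.Theorems.EisensteinPrimesAcTwistDeformationSUROfTate
import Literature.NumberTheory.IwasawaTheory.Greenberg2006.CohomologyCofiniteGenerationLeTwoOfTate
import HarnessLib

/-!
# T28 re-typing (`OfTate`) of `EisensteinPrimesAcTwistDeformationLocSurj.lean`

Route `EisensteinPrimes` (rung K5), crux 2 `GoodLatticeBDPValue` (stmt-BirchSwinnertonDyer-19032), line `halves`;
cell `bsd-eis`, seat `bsd-line-x1-p1` LEAD g8, lane «T28 / TATE RE-PLUMB» (helper, `--supports`).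

This file re-types, token for token, the theorems of `EisensteinPrimesAcTwistDeformationLocSurj` that carry
Greenberg 2006 Prop. 3.2 BY NAME (`h32 : (∀ (L : Type) [Field L] [NumberField L], Literature.NumberTheory.GaloisCohomology.tateGlobalEulerPoincareCharacteristic L)`, cofinite generation of
`Hⁱ(K_Σ/K, 𝒟)` / `Hⁱ(K_v, 𝒟)` for EVERY `i`, every number field, every prime) with that hypothesis replaced by
Tate's global Euler–Poincaré characteristic BY NAME for every number field
(`h32 : ∀ L, GaloisCohomology.tateGlobalEulerPoincareCharacteristic L`, Milne ADT I Thm. 5.1): on this line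
Prop. 3.2 is read in degrees `i ≤ 2` only (global clause; the local clause is the unconditional
`Greenberg2006.prop32_local_holds`), and in those degrees it follows from Tate's formula alone
(`Greenberg2006.prop32_global_le_two_of_tate`, file `CohomologyCofiniteGenerationLeTwoOfTate`: `H⁰`/`H¹` of
`G_{K,S}` with finite coefficients are finite unconditionally, `H²` by Tate, and Greenberg's dévissage for `Hⁿ`
involves `Hⁿ`, `Hⁿ⁻¹` only).  Statements are otherwise VERBATIM (same binder order, new names `<name>_ofTate`);
proofs are the tree proofs with the two reading lemmas substituted and the re-typed callees called.
EFFECT for the crux: Harari Thm. 17.13 (a) (`poitouTate_restricted_three_le`) is no longer consumed through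
Prop. 3.2 at every number field, only at totally complex fields (Greenberg 2006 Prop. 4.1 is typed totally
imaginary; `cd_p ≤ 2` and the `H²` bookkeeping at the imaginary quadratic `K`), which is what the tree's
class-formation road (`RestrictedRamificationCdTwoOfH3Mu`, lane PT3-TC) proves.

Theorems only; no definition, no named fact, no `sorry`, no instance. HONEST FRAMING: conditional on the PUBLISHED
named facts carried as hypotheses; closes nothing by itself; no summit statement / BSD / the crux is proved here.

## References
* R. Greenberg, *On the structure of certain Galois cohomology groups*, Doc. Math. Extra Vol. Coates (2006), Prop. 3.2 (p. 358). [Greenberg2006]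
* J. S. Milne, *Arithmetic Duality Theorems*, 2nd ed. (2006), I Thm. 5.1 (p. 67). [MilneADT2006]
* (the references of the re-typed file apply verbatim)
-/

set_option autoImplicit false

noncomputable section

open scoped Classical
open NumberField IsDedekindDomain Field Multiplicative PowerSeries
open Literature.NumberTheory.EllipticCurves Literature.NumberTheory.EllipticCurves.GreenbergSelmer
  Literature.NumberTheory.EllipticCurves.GreenbergVatsal2000 Literature.NumberTheory.GaloisRepresentations
  Literature.NumberTheory.EllipticCurves.KellerYin2024 Literature.NumberTheory.EllipticCurves.IwasawaDual
  Literature.NumberTheory.IwasawaTheory Literature.NumberTheory.IwasawaTheory.Greenberg2016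
  Literature.NumberTheory.IwasawaTheory.Greenberg2006
  Summit.BirchSwinnertonDyer.BirchSwinnertonDyer.Theorems.GreenbergFullAtSelmer

namespace Summit.BirchSwinnertonDyer.BirchSwinnertonDyer.Theorems.AcTwistDeformation

section LocSurj

variable {K : Type} [Field K] [NumberField K] (S : Set (HeightOneSpectrum (𝓞 K))) {p : ℕ} [Fact p.Prime]
  {A : Type} [AddCommGroup A] [Module ℤ_[p] A] [TopologicalSpace A] [DiscreteTopology A]
  [TopologicalSpace (PowerSeries ℤ_[p])] [IsTopologicalRing (PowerSeries ℤ_[p])]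
  [IsTopologicalAddGroup (BigRepModule ℤ_[p] p A)] [ContinuousSMul (PowerSeries ℤ_[p]) (BigRepModule ℤ_[p] p A)]
  (hS : ∀ v : HeightOneSpectrum (𝓞 K), ((p : ℕ) : 𝓞 K) ∈ v.asIdeal → v ∈ S)
  (κ : ZpExtension K p) (ρ₀ : ContinuousRep (GaloisGroupUnramifiedOutside K S) ℤ_[p] A)
  {M : Type} [AddCommGroup M] [DistribMulAction (absoluteGaloisGroup K) M] [TopologicalSpace M]
  [DiscreteTopology M]
  (ψ : A ≃+ M) (hψ : ∀ (σ : absoluteGaloisGroup K) (a : A), ψ (ρ₀ (toUnramifiedQuot K S σ) a) = σ • ψ a)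

include hψ in
/-- **[T28 `OfTate` re-typing: Greenberg 2006 Prop. 3.2 by name ↦ Milne ADT I Thm. 5.1 by name (Prop. 3.2 is read in degrees ≤ 2 only, `prop32_global_le_two_of_tate`).]** [cite: MilneADT2006, I Thm. 5.1 (p. 67)] **`K_∞`-SIDE GLOBAL-TO-LOCAL SURJECTIVITY, IN THE KERNEL FROM `SUR(𝐃₁, 𝓛_v)`.** Hypotheses: those of
`bigRep_fullAt_SUR_ofTate` (Greenberg 2016 Prop. 2.6.3 and Greenberg 2006 §3–5 BY NAME; `K` imaginary quadratic;
`A ≃ ℚ_p/ℤ_p` with scalar action; `S` finite, `⊇ {w ∣ p} = {v, v̄}`, every `w ∈ S` finitely decomposed;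
`corank_Λ S_{𝓛_v}(K, 𝐃₁) = 0`, e.g. from [RH] via file 5), the Shapiro descent `F` of `ψ : A ≃ M`, a finite
`S₀ ⊆ S` of places `w ∤ p` with `κ(D_w) = p^{a_w} ℤ_p` exactly, elements `σ_{w,i}` with `κ(σ_{w,i}) = i`.
Conclusion: for ANY `y_{w,i} ∈ H¹(ker κ ⊓ D_w, M)` there is `u ∈ H¹_{𝓕_nr^{S₀}}(K_∞, M)` with
`res_{ker κ ⊓ D_w}(conj_{σ_{w,i}} u) = y_{w,i}` (`w ∈ S₀`, `i < p^{a_w}`) — the map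
`H¹_{𝓕_nr^{S₀}}(K_∞, M) → ∏_{w ∈ S₀} ∏_{η ∣ w} H¹(K_{∞,η}, M)` is ONTO.
[cite: Greenberg2016Selmer, Prop. 2.6.3 and §1 p. 3] [cite: KellerYin2024, Prop. 1.2.5 (eq:Gr to imp) (arXiv:2402.12781v2 TeX L789–800)]
[cite: PollackWeston2011, App. A, Prop. A.2 (proof)] [cite: SkinnerUrban2014, §3.1.2 and Prop. 3.2.3] -/
theorem exists_mem_unrSelmer_forall_resOfLe_conjH1_eq_ofTate (h263 : prop263_sur_of_crk)
    (h41 : prop41_globalEulerPoincareCorank) (h42 : prop42_localEulerPoincareCorank)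
    (h5A : sec5A_localH2_subsingleton_of_LOC1) (h32 : (∀ (L : Type) [Field L] [NumberField L], Literature.NumberTheory.GaloisCohomology.tateGlobalEulerPoincareCharacteristic L))
    (hSf : S.Finite) (hK : IsImaginaryQuadratic K) (e : A ≃ₗ[ℤ_[p]] QpModZp p)
    (hscalar : ∀ g : GaloisGroupUnramifiedOutside K S, ∃ t : ℤ_[p]ˣ, ∀ a : A, ρ₀ g a = (t : ℤ_[p]) • a)
    (hsup : ∀ v : HeightOneSpectrum (𝓞 K), v ∈ S →
      ∃ σ : absoluteGaloisGroup (Place.Completion (Sum.inr v : Place K)),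
        κ (absGaloisRestrict K _ σ) ≠ 1)
    {v vbar : HeightOneSpectrum (𝓞 K)} (hne : vbar ≠ v)
    (hv : ((p : ℕ) : 𝓞 K) ∈ v.asIdeal) (hvbar : ((p : ℕ) : 𝓞 K) ∈ vbar.asIdeal)
    (hSp : ∀ w : HeightOneSpectrum (𝓞 K), ((p : ℕ) : 𝓞 K) ∈ w.asIdeal → w = v ∨ w = vbar)
    (hSel : HasCorank (PowerSeries ℤ_[p])
      (fullAtSpecification S (bigRep (κ.liftUnramifiedOutside S hS) ρ₀) (Sum.inr v)).selmer 0)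
    (hSelfg : IsCofinitelyGenerated (PowerSeries ℤ_[p])
      (fullAtSpecification S (bigRep (κ.liftUnramifiedOutside S hS) ρ₀) (Sum.inr v)).selmer)
    (hA : ∀ a : A, ∃ k : ℕ, p ^ k • a = 0)
    {F : (bigRep (κ.liftUnramifiedOutside S hS) ρ₀).H 1 →+ subgroupH1 κ.kerSubgroup M}
    (hF : ∀ (c : contOneCocycles (bigRep (κ.liftUnramifiedOutside S hS) ρ₀).toTopRep)
      (z : contOneCocycles (discreteTopRep κ.kerSubgroup M)),
      (∀ h : κ.kerSubgroup, z.1 h = ψ ((c.1 (toUnramifiedQuot K S h) : BigRepModule ℤ_[p] p A) 0)) →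
      F (oneCocycleClass _ c) = oneCocycleClass _ z)
    (S₀ : Finset (HeightOneSpectrum (𝓞 K))) (hS₀S : ∀ w ∈ S₀, w ∈ S)
    (hS₀p : ∀ w ∈ S₀, ((p : ℕ) : 𝓞 K) ∉ w.asIdeal) (a : HeightOneSpectrum (𝓞 K) → ℕ)
    (hdiv : ∀ w ∈ S₀, ∀ δ ∈ decomp (K := K) w, (p : ℤ_[p]) ^ a w ∣ (κ δ).toAdd)
    (hd₀ : ∀ w ∈ S₀, ∃ δ ∈ decomp (K := K) w, (κ δ).toAdd = (p : ℤ_[p]) ^ a w)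
    (σrep : HeightOneSpectrum (𝓞 K) → ℕ → absoluteGaloisGroup K)
    (hσrep : ∀ w ∈ S₀, ∀ i : ℕ, i < p ^ a w → (κ (σrep w i)).toAdd = (i : ℤ_[p]))
    (y : ∀ w : HeightOneSpectrum (𝓞 K), ℕ → subgroupH1 (κ.kerSubgroup ⊓ decomp (K := K) w) M) :
    ∃ u ∈ unrSelmer κ M vbar (↑S₀ : Set (HeightOneSpectrum (𝓞 K))),
      ∀ w ∈ S₀, ∀ i : ℕ, i < p ^ a w →
        resOfLe M (inf_le_left : κ.kerSubgroup ⊓ decomp (K := K) w ≤ κ.kerSubgroup)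
          (conjH1 κ.kerSubgroup M (σrep w i) u) = y w i := by
  -- cocycle representatives of the targets
  have hζex : ∀ (w : HeightOneSpectrum (𝓞 K)) (i : ℕ),
      ∃ ζ : contOneCocycles (discreteTopRep ↥(κ.kerSubgroup ⊓ decomp (K := K) w) M),
        oneCocycleClass _ ζ = y w i := fun w i ↦ oneCocycleClass_surjective _ _
  choose ζ hζ using hζex
  -- local cocycles at the places of `S₀`
  have hcls : ∀ w : HeightOneSpectrum (𝓞 K), w ∈ S₀ →
      ∃ c' : contOneCocycles (localRep S (bigRep (κ.liftUnramifiedOutside S hS) ρ₀) (Sum.inr w : Place K)).toTopRep,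
        ∀ i : ℕ, i < p ^ a w →
          ∀ (x : ↥(κ.kerSubgroup ⊓ decomp (K := K) w)) (τ : absoluteGaloisGroup (w.adicCompletion K)),
            absGaloisRestrict K (w.adicCompletion K) τ = (x : absoluteGaloisGroup K) →
            (ζ w i).1 x = ψ ((c'.1 τ : BigRepModule ℤ_[p] p A) (i : ℕ)) := fun w hw ↦
    exists_localCocycle_forall_eval S hS κ ρ₀ ψ hψ hA w (hdiv w hw) (hd₀ w hw) (ζ w)
  choose c' hc' using hcls
  -- the local targets: `[c'_w]` at `w ∈ S₀`, `0` elsewhere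
  let xloc : ∀ w : HeightOneSpectrum (𝓞 K), (localRep S (bigRep (κ.liftUnramifiedOutside S hS) ρ₀) (Sum.inr w : Place K)).H 1 := fun w ↦
    if hw : w ∈ S₀ then oneCocycleClass _ (c' w hw) else 0
  let xall : ∀ pl : Place K, (localRep S (bigRep (κ.liftUnramifiedOutside S hS) ρ₀) pl).H 1 := fun pl ↦
    @Sum.rec (InfinitePlace K) (HeightOneSpectrum (𝓞 K)) (fun pl ↦ (localRep S (bigRep (κ.liftUnramifiedOutside S hS) ρ₀) pl).H 1)
      (fun _ ↦ 0) (fun w ↦ xloc w) pl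
  let q : (fullAtSpecification S (bigRep (κ.liftUnramifiedOutside S hS) ρ₀) (Sum.inr v)).QGlobal := fun η ↦
    (fullAtSpecification S (bigRep (κ.liftUnramifiedOutside S hS) ρ₀) (Sum.inr v) η.1).mkQ (xall η.1)
  -- `SUR(𝐃₁, 𝓛_v)`
  have hSUR : (fullAtSpecification S (bigRep (κ.liftUnramifiedOutside S hS) ρ₀) (Sum.inr v)).SUR :=
    bigRep_fullAt_SUR_ofTate (S := S) (hS := hS) (κ := κ) (ρ₀ := ρ₀) h263 h41 h42 h5A h32 hSf hK e hscalar hsup hne hv hvbar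
      hSel hSelfg
  obtain ⟨ξ, hξ⟩ := hSUR q
  obtain ⟨c, rfl⟩ := oneCocycleClass_surjective _ ξ
  -- the local components of `[c]` at the finite `w ∈ S`, `w ≠ v`
  have hcomp : ∀ w : HeightOneSpectrum (𝓞 K), w ∈ S → w ≠ v →
      loc S (bigRep (κ.liftUnramifiedOutside S hS) ρ₀) (Sum.inr w) 1 (oneCocycleClass _ c) = xloc w := by
    intro w hwS hwv
    have hη := congrFun hξ ⟨Sum.inr w, (inSigma_inr_iff S w).mpr hwS⟩
    simp only [Specification.phi, LinearMap.pi_apply, LinearMap.coe_comp, Function.comp_apply, q, xall] at hη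
    rw [Submodule.mkQ_apply, Submodule.mkQ_apply, Submodule.Quotient.eq,
      fullAtSpecification_of_ne (S := S) (ρ := bigRep (κ.liftUnramifiedOutside S hS) ρ₀)
        (η := (Sum.inr v : Place K)) (w := (Sum.inr w : Place K)) (fun h ↦ hwv (Sum.inr_injective h)), Submodule.mem_bot,
      sub_eq_zero] at hη
    exact hη
  -- landing in `H¹_{𝓕_nr^{S₀}}`
  have hloc0 : ∀ w : HeightOneSpectrum (𝓞 K), w ∈ S → w ≠ v → w ∉ (↑S₀ : Set (HeightOneSpectrum (𝓞 K))) ∨ w = vbar →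
      loc S (bigRep (κ.liftUnramifiedOutside S hS) ρ₀) (Sum.inr w) 1 (oneCocycleClass _ c) = 0 := by
    intro w hwS hwv hw
    rw [hcomp w hwS hwv]
    have hw' : w ∉ S₀ := by
      rcases hw with hw | rfl
      · exact fun h ↦ hw (Finset.mem_coe.mpr h)
      · exact fun h ↦ hS₀p _ h hvbar
    exact dif_neg hw'
  refine ⟨F (oneCocycleClass _ c),
    shapiroDescent_mem_unrSelmer_of_loc_eq_zero S hS κ ρ₀ ψ hψ hA hF hv hne hSp _ c hloc0,
    fun w hw i hi ↦ ?_⟩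
  -- the local components are the evaluation classes
  have hwv : w ≠ v := fun h ↦ hS₀p w hw (h ▸ hv)
  have hcc' : loc S (bigRep (κ.liftUnramifiedOutside S hS) ρ₀) (Sum.inr w) 1 (oneCocycleClass _ c) = oneCocycleClass _ (c' w hw) := by
    rw [hcomp w (hS₀S w hw) hwv]
    exact dif_pos hw
  rw [← hζ w i]
  refine resOfLe_conjH1_shapiroDescent_eq S hS κ ρ₀ ψ hψ hF w (σrep w i) c (c' w hw) hcc' (ζ w i)
    fun x τ hτ ↦ ?_
  rw [hσrep w hw i hi]
  exact hc' w hw i hi x τ hτ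

end LocSurj

end Summit.BirchSwinnertonDyer.BirchSwinnertonDyer.Theorems.AcTwistDeformation

end
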